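import Summits.Schanuel.Schanuel.Theorems.ZilberEacDegenerateDirectionGeneral
import Summits.Schanuel.Schanuel.Theorems.ZilberEacFermatUnitLine
import HarnessLib

/-!
# The exponential-polynomial regime, CXVI: EVERY GRAPH FIBRE `y₀ = R(x₀, x₁, y₁)` over a curve
# with a degenerate direction — case ∧ dense; over the Fermat curves for every `R`

HONEST FRAMING.  Cell `pub-schanuel` (Zilber's Exponential-Algebraic Closedness, case ladder;
host summit Schanuel), seat 2, gen 34.  The W-form of the degenerate-direction engine for the
family of files CXII/CXIII: **`unprojectedDensityQuestion_relGraphFibre_of_degenerateDirection`**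
— `A ∈ ℂ[x₀, x₁]` irreducible (rows form `F`), a place `x₀ = s^{-k}`, `x₁ = Φ(s)s^{-M}` (`M ≥ 1`)
with a degenerate direction (`z^k = 2πi`, `Re(Φ(0)z^M) < 0`), `R ∈ ℂ[x₀, x₁, y₁]` with
`R(x, 0) ≠ 0` somewhere on the curve, `R(x, t) ≠ 0` for some point of the curve and `t ≠ 0`, and
the curve not in a line of rational slope: the surface `{A(x) = 0, y₀ = R(x₀, x₁, y₁)}` is in
Mantova–Masser's case AND its unprojected exponential points are Zariski dense (relation
`y₀ − R`, degenerate part `y₀ − R(x, 0)` of degree one; file CXIV (b)).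
**`unprojectedDensityQuestion_fermat_relGraphFibre`**: over the Fermat curve `x₀ⁿ + x₁ⁿ = 1`
(`n ≥ 2`), EVERY such `R` — vastly extending gen 28's `y₀ = x₁ − ζx₀ + θ` and gen 34's
`y₀ = 1 − y₁` (Mantova–Masser's example).  Decided families of an OPEN question; the question in
general, EC(3,2) and Zilber's EAC remain OPEN; NOT Schanuel's conjecture (neither used nor
implied); EAC ⇏ SC.
-/

noncomputable section

open Filter Topology Set Complex Polynomial
open Literature.NumberTheory.Transcendental Literature.ModelTheory.Zilber
open Literature.ModelTheory.ExponentialFields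

set_option linter.dupNamespace false

namespace Summit.Schanuel.Schanuel.Theorems

section RelGraphFibreDegenerate

/-- Evaluation of the relation `y₀ − R ∈ ℂ[x₀, x₁, y₁][y₀]`. [folklore] -/
theorem eval_X_sub_C_relation (R : MvPolynomial (Fin 3) ℂ) (v : Fin 3 → ℂ) (y : ℂ) :
    ((Polynomial.X - Polynomial.C R : Polynomial (MvPolynomial (Fin 3) ℂ)).map
      (MvPolynomial.eval v)).eval y = y - MvPolynomial.eval v R := by
  simp [Polynomial.map_sub, Polynomial.map_X, Polynomial.map_C]

/-- Evaluation of `y₀ − c ∈ ℂ[x₀][x₁][y₀]`. [folklore] -/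
theorem eval_X_sub_C_rows (c : ℂ[X][X]) (x₀ x₁ y : ℂ) :
    ((Polynomial.X - Polynomial.C c : Polynomial ℂ[X][X]).map
      (Polynomial.eval₂RingHom (Polynomial.evalRingHom x₀) x₁)).eval y =
      y - (c.map (Polynomial.evalRingHom x₀)).eval x₁ := by
  rw [Polynomial.map_sub, Polynomial.map_X, Polynomial.map_C, Polynomial.eval_sub, Polynomial.eval_X,
    Polynomial.eval_C, Polynomial.coe_eval₂RingHom, Polynomial.eval_map]

/-- **GRAPH FIBRES `y₀ = R(x₀, x₁, y₁)` OVER A CURVE WITH A DEGENERATE DIRECTION: case ∧ dense.**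
[cite: MantovaMasser2023, §1 Further remarks, p. 5 (the question, open in general)] (new) -/
theorem unprojectedDensityQuestion_relGraphFibre_of_degenerateDirection
    {A : MvPolynomial (Fin 2) ℂ} (hirr : Irreducible A) (F : ℂ[X][X])
    (hFA : ∀ x y : ℂ, MvPolynomial.eval ![x, y] A = (F.map (Polynomial.evalRingHom x)).eval y)
    (hn : 1 ≤ F.natDegree) {k : ℕ} (hk : 1 ≤ k) {M : ℕ} (hM : 1 ≤ M) {Φ : ℂ → ℂ}
    (hΦan : AnalyticAt ℂ Φ 0)
    (hplace : ∀ᶠ s in 𝓝[≠] (0 : ℂ),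
      (F.map (Polynomial.evalRingHom (s ^ k)⁻¹)).eval (Φ s * (s ^ M)⁻¹) = 0)
    {z : ℂ} (hz : z ^ k = 2 * Real.pi * I) (hdir : (Φ 0 * z ^ M).re < 0)
    (R : MvPolynomial (Fin 3) ℂ)
    (hR0 : ∃ x : Fin 2 → ℂ, MvPolynomial.eval x A = 0 ∧ MvPolynomial.eval ![x 0, x 1, 0] R ≠ 0)
    (hpt : ∃ (x : Fin 2 → ℂ) (t : ℂ), MvPolynomial.eval x A = 0 ∧ t ≠ 0 ∧
      MvPolynomial.eval ![x 0, x 1, t] R ≠ 0)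
    (hline : ∀ m : Fin 2 → ℤ, m ≠ 0 → ∀ c : ℂ, ∃ x : Fin 2 → ℂ,
      MvPolynomial.eval x A = 0 ∧ (m 0 : ℂ) * x 0 + (m 1 : ℂ) * x 1 ≠ c) :
    MMCaseDimPiOneFree {w : Fin 2 ⊕ Fin 2 → ℂ |
        MvPolynomial.eval ![w (Sum.inl 0), w (Sum.inl 1)] A = 0 ∧
        w (Sum.inr 0) = MvPolynomial.eval ![w (Sum.inl 0), w (Sum.inl 1), w (Sum.inr 1)] R} ∧
      UnprojectedDense {w : Fin 2 ⊕ Fin 2 → ℂ |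
        MvPolynomial.eval ![w (Sum.inl 0), w (Sum.inl 1)] A = 0 ∧
        w (Sum.inr 0) = MvPolynomial.eval ![w (Sum.inl 0), w (Sum.inl 1), w (Sum.inr 1)] R} := by
  classical
  refine ⟨mmCase_relGraphFibre (R := R) hirr hpt hline, ?_⟩
  have hFirr : Irreducible F := (irreducible_rows_iff hFA).1 hirr
  -- the degenerate part `y₀ − R(x, 0)` in rows form
  obtain ⟨Φr, hΦr⟩ := exists_rowsEquiv
  set R₀ : MvPolynomial (Fin 2) ℂ :=
    MvPolynomial.aeval ![MvPolynomial.X 0, MvPolynomial.X 1, (0 : MvPolynomial (Fin 2) ℂ)] R with hR₀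
  have hR₀ev : ∀ x₀ x₁ : ℂ, MvPolynomial.eval ![x₀, x₁] R₀ = MvPolynomial.eval ![x₀, x₁, 0] R := by
    intro x₀ x₁
    rw [hR₀, eval_aeval_eq_aeval]
    have e : (fun i => MvPolynomial.eval ![x₀, x₁]
        ((![MvPolynomial.X 0, MvPolynomial.X 1, (0 : MvPolynomial (Fin 2) ℂ)] :
          Fin 3 → MvPolynomial (Fin 2) ℂ) i)) = ![x₀, x₁, 0] := by
      funext i; fin_cases i <;> simp
    rw [e]
    rfl
  set G : Polynomial (MvPolynomial (Fin 3) ℂ) := Polynomial.X - Polynomial.C R with hGdef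
  set G₀ : Polynomial ℂ[X][X] := Polynomial.X - Polynomial.C (Φr R₀) with hG₀def
  have hG₀ : ∀ x₀ x₁ y : ℂ,
      (G₀.map (Polynomial.eval₂RingHom (Polynomial.evalRingHom x₀) x₁)).eval y =
        (G.map (MvPolynomial.eval ![x₀, x₁, 0])).eval y := by
    intro x₀ x₁ y
    rw [hG₀def, hGdef, eval_X_sub_C_rows, eval_X_sub_C_relation, ← hΦr, hR₀ev]
  have hd : 1 ≤ G₀.natDegree := by rw [hG₀def, Polynomial.natDegree_X_sub_C]
  have htop : ¬ F ∣ G₀.leadingCoeff := by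
    rw [hG₀def, Polynomial.leadingCoeff_X_sub_C]
    exact fun h => hFirr.not_isUnit (isUnit_of_dvd_unit h isUnit_one)
  have hbot : ¬ F ∣ G₀.coeff 0 := by
    rw [hG₀def, Polynomial.coeff_sub, Polynomial.coeff_X_zero, Polynomial.coeff_C_zero, zero_sub]
    intro hneg
    obtain ⟨c, hc⟩ := (dvd_neg (α := ℂ[X][X])).1 hneg
    obtain ⟨x, hAx, hRx⟩ := hR0
    apply hRx
    have e : x = ![x 0, x 1] := by funext i; fin_cases i <;> rfl
    rw [← hR₀ev, hΦr, hc, Polynomial.map_mul, Polynomial.eval_mul, ← hFA, ← e, hAx, zero_mul]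
  refine unprojectedDense_degenerateDirection' F hFirr hn hk hM hΦan hplace hz hdir G G₀ hG₀ hd htop
    hbot (isIrreducibleClosed_relGraphFibre _ hirr) (le_of_eq (zariskiDim_relGraphFibre _ hirr)) ?_
  filter_upwards [hplace] with s hs y _ hy
  rw [hGdef, eval_X_sub_C_relation, sub_eq_zero] at hy
  refine ⟨?_, ?_⟩
  · simp only [Sum.elim_inl, Matrix.cons_val_zero, Matrix.cons_val_one]
    rw [hFA]
    exact hs
  · simp only [Sum.elim_inr, Sum.elim_inl, Matrix.cons_val_zero, Matrix.cons_val_one]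
    exact hy

/-- **Over the Fermat curve `x₀ⁿ + x₁ⁿ = 1` (`n ≥ 2`): EVERY graph fibre `y₀ = R(x₀, x₁, y₁)` with
`R(x, 0) ≠ 0` somewhere on the curve and `R(x, t) ≠ 0` for some point of the curve and `t ≠ 0` is
in Mantova–Masser's case AND dense** (place `x₀ = 1/s`, `x₁ = e^{iπ/n}(1 − sⁿ)^{1/n}/s`, direction
`2πi`). [cite: MantovaMasser2023, §1 Further remarks, p. 5 (the question, open in general)]
(new) -/
theorem unprojectedDensityQuestion_fermat_relGraphFibre {n : ℕ} (hn : 2 ≤ n)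
    (R : MvPolynomial (Fin 3) ℂ)
    (hR0 : ∃ x : Fin 2 → ℂ, x 0 ^ n + x 1 ^ n = 1 ∧ MvPolynomial.eval ![x 0, x 1, 0] R ≠ 0)
    (hpt : ∃ (x : Fin 2 → ℂ) (t : ℂ), x 0 ^ n + x 1 ^ n = 1 ∧ t ≠ 0 ∧
      MvPolynomial.eval ![x 0, x 1, t] R ≠ 0) :
    MMCaseDimPiOneFree {w : Fin 2 ⊕ Fin 2 → ℂ |
        MvPolynomial.eval ![w (Sum.inl 0), w (Sum.inl 1)]
          (MvPolynomial.X 0 ^ n + MvPolynomial.X 1 ^ n - 1 : MvPolynomial (Fin 2) ℂ) = 0 ∧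
        w (Sum.inr 0) = MvPolynomial.eval ![w (Sum.inl 0), w (Sum.inl 1), w (Sum.inr 1)] R} ∧
      UnprojectedDense {w : Fin 2 ⊕ Fin 2 → ℂ |
        MvPolynomial.eval ![w (Sum.inl 0), w (Sum.inl 1)]
          (MvPolynomial.X 0 ^ n + MvPolynomial.X 1 ^ n - 1 : MvPolynomial (Fin 2) ℂ) = 0 ∧
        w (Sum.inr 0) = MvPolynomial.eval ![w (Sum.inl 0), w (Sum.inl 1), w (Sum.inr 1)] R} := by
  classical
  have hn1 : 1 ≤ n := by omega
  have hn0 : n ≠ 0 := by omega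
  -- the rows form of the Fermat curve and the place (as in file CXI)
  set F : ℂ[X][X] := Polynomial.X ^ n + Polynomial.C (Polynomial.X ^ n - 1 : Polynomial ℂ)
    with hFdef
  have hFdeg : F.natDegree = n := by rw [hFdef, Polynomial.natDegree_X_pow_add_C]
  have hFeval : ∀ x₀ x₁ : ℂ, (F.map (Polynomial.evalRingHom x₀)).eval x₁ = x₁ ^ n + (x₀ ^ n - 1) := by
    intro x₀ x₁
    rw [hFdef]
    simp [Polynomial.map_add, Polynomial.map_pow, Polynomial.map_X, Polynomial.map_C]
  have hFA : ∀ x y : ℂ, MvPolynomial.eval ![x, y]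
      (MvPolynomial.X 0 ^ n + MvPolynomial.X 1 ^ n - 1 : MvPolynomial (Fin 2) ℂ) =
      (F.map (Polynomial.evalRingHom x)).eval y := by
    intro x y
    rw [hFdef]
    exact eval_fermatMv_rows n x y
  obtain ⟨q, d, hqan, -, hq0, -, hqn⟩ := fermat_branch_facts n hn1
  set ζ : ℂ := Complex.exp (Real.pi / n * I) with hζdef
  have hζn : ζ ^ n = -1 := by
    rw [hζdef, ← Complex.exp_nat_mul, show (n : ℂ) * (Real.pi / n * I) = Real.pi * I by
      field_simp, Complex.exp_pi_mul_I]
  set Φ : ℂ → ℂ := fun s => ζ * q (s ^ n) with hΦdef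
  have hsn : AnalyticAt ℂ (fun s : ℂ => s ^ n) 0 := analyticAt_id.pow n
  have h0n : (0 : ℂ) ^ n = 0 := zero_pow hn0
  have hΦan : AnalyticAt ℂ Φ 0 := analyticAt_const.mul (hqan.comp_of_eq hsn h0n)
  have hΦ0 : Φ 0 = ζ := by simp [hΦdef, h0n, hq0]
  have hqn' : ∀ᶠ s in 𝓝 (0 : ℂ), q (s ^ n) ^ n = 1 - s ^ n := by
    have h := hsn.continuousAt.tendsto
    rw [h0n] at h
    exact h.eventually hqn
  have hplace : ∀ᶠ s in 𝓝[≠] (0 : ℂ),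
      (F.map (Polynomial.evalRingHom (s ^ 1)⁻¹)).eval (Φ s * (s ^ 1)⁻¹) = 0 := by
    filter_upwards [self_mem_nhdsWithin, nhdsWithin_le_nhds hqn'] with s hs hqs
    have hs' : (s : ℂ) ≠ 0 := hs
    rw [hFeval, hΦdef]
    simp only [pow_one, mul_pow, inv_pow, hζn, hqs]
    field_simp
    ring
  have hz : (2 * Real.pi * I : ℂ) ^ 1 = 2 * Real.pi * I := pow_one _
  have hdir : (Φ 0 * (2 * Real.pi * I) ^ 1).re < 0 := by
    have hsin : 0 < Real.sin (Real.pi / n) := by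
      apply Real.sin_pos_of_pos_of_lt_pi
      · positivity
      · have : (1 : ℝ) < n := by exact_mod_cast hn
        rw [div_lt_iff₀ (by positivity)]
        nlinarith [Real.pi_pos]
    have him : ζ.im = Real.sin (Real.pi / n) := by
      rw [hζdef, show (Real.pi / n * I : ℂ) = ((Real.pi / n : ℝ) : ℂ) * I by push_cast; ring,
        Complex.exp_ofReal_mul_I_im]
    have hbre : (2 * Real.pi * I : ℂ).re = 0 := by simp
    have hbim : (2 * Real.pi * I : ℂ).im = 2 * Real.pi := by simp
    rw [hΦ0, pow_one, Complex.mul_re, hbre, hbim, him, mul_zero, zero_sub]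
    nlinarith [hsin, Real.pi_pos]
  refine unprojectedDensityQuestion_relGraphFibre_of_degenerateDirection (irreducible_fermatMv n hn1)
    F hFA (by rw [hFdeg]; exact hn1) le_rfl le_rfl hΦan hplace hz hdir R ?_ ?_
    (fermat_exists_off_rationalLine n hn)
  · obtain ⟨x, hx, hR⟩ := hR0
    exact ⟨x, by rw [eval_fermatMv, hx, sub_self], hR⟩
  · obtain ⟨x, t, hx, ht, hR⟩ := hpt
    exact ⟨x, t, by rw [eval_fermatMv, hx, sub_self], ht, hR⟩

end RelGraphFibreDegenerate

end Summit.Schanuel.Schanuel.Theorems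

end
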